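import Literature.IUT.HodgeTheaters.PiAvatarKitCoreTheta
import HarnessLib

/-!
# [IUTchI] Def 4.1 / Def 6.1 / Prop 6.7 AT THE GENUINE-SHAPE Θ-NF KIT WITH PARAMETRIC BAD-PAIR DATA: the §4 base-Θ datum, its core
# agreement `KitCore`, the `φ^NF` dictionary and law (γ) `ThetaAgrees` — abc-iut-L5-t4's (C″) `PiAvatarKitCoreTheta` (p465980) RE-RUN at
# `baseKitThetaNFOfBadPairs CG hS M hA hI B ΛBad` instead of the `X̲→`-stand-in (row «PROP67-EX44-AT-OFBADPAIRS», file 1 of 3: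
# defs + `rfl` bookkeeping + laws; the stand-in datum is RECOVERED as the special case `B := badPairAtArrow hA`, by `rfl`)

S. Mochizuki, *Inter-universal Teichmüller theory I*, kurims manuscript (May 2020), Definition 4.1 (i)–(vi) pp. 95–98, Example 4.3 p. 99,
Example 4.4 (i)(ii)(iv) pp. 106–107, Definition 6.1 (i)–(vii) pp. 156–159, Proposition 6.7 p. 167 ([IUTchI] Def 6.1 (i) p.156)
[claim: Mochizuki2012, status: disputed] (D-0012 claim key, series status DISPUTED — constructions over abc-iut-L5-t2's REAL `InitialThetaData`;
nothing of the series is asserted, no side is taken on [IUTchIII] Cor. 3.12).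

## What this file builds and why (abc-iut-L5-lead g8 L5 ROWS #1 2026-08-27T03:05:03Z, UPGRADE row «PROP67-EX44-AT-OFBADPAIRS»)

abc-iut-L5-t4's (C″) file `PiAvatarKitCoreTheta` (p465980) builds the §4 datum `baseThetaDatumThetaStandIn ES`, the FROZEN `KitCore` and law (γ)
over the Θ-NF STAND-IN kit `baseKitThetaNFStandIn CG hS M hA hI` — i.e. over abc-iut-L5-t4's genuine-shape kit `baseKitThetaNFOfBadPairs` with the
bad-pair DATA FIXED to the `X̲→`-recipe `B := badPairAtArrow hA` (laws `localArrowLaw_local_of_torsionMonodromy`).  The Group-Θ tokens of the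
cone (IUTchI:Prop6.7, Ex4.4(i)(ii), Ex4.5(i)) were discharged at that stand-in (p487254, p488982) with the honest label «[Θ-NF stand-in kit]».
THIS FILE removes the specialisation: for ARBITRARY bad-pair DATA `B : ∀ v ∈ V̲^bad, BadPairAt v` with its laws `ΛBad` — abc-iut-L5-t4's
§Slots `localDataOfBadPairs`, `nfKitThetaOfBadPairs`, `multKitThetaNFOfBadPairs`, `evalBinderThetaNFOfBadPairs`,
`nonempty_kitCore_baseKitThetaNFOfBadPairs`, `thetaAgrees_baseKitThetaNFOfBadPairs` (p465512/p465980 lineage) consumed BY NAME — it builds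
* `baseThetaDatumThetaOfBadPairs B ΛBad ES : BaseThetaDatum` — the §4 base-Θ datum of the REAL initial Θ-data over the PARAMETRIC genuine-shape
  Θ-NF kit: `BaseThetaDatum.ofKitCore` at `K := baseKitThetaNFOfBadPairs … B ΛBad`, `N := nfKitThetaOfBadPairs … B ΛBad` (`hNF` discharged from `M`),
  `B' :=` tautological, `hl5 := five_le_l` (Def 3.1 (c)), the two place theorems, `E := evalBinderThetaNFOfBadPairs … ES`;
* `kitCoreThetaOfBadPairs B ΛBad ES` — the FROZEN `KitCore`, INHABITED; `nfLinkThetaOfBadPairs` — the `φ^NF` dictionary (identity);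
* `thetaAgrees_thetaOfBadPairs` — law (γ) `KitCore.ThetaAgrees` for the multiplicative kit generated by the sections (`multKitThetaNFOfBadPairs`);
* `exists_endo_not_isIso_thetaOfBadPairs` — (O1) of abc-iut-w4-d054 p456090 met at every bad index (by tag);
* `baseThetaDatumThetaStandIn_eq_ofBadPairs` / `kitCoreThetaStandIn_eq_ofBadPairs` — the (C″) stand-in datum and core ARE this file's at
  `B := badPairAtArrow hA` (`rfl`; nothing of p465980 restated).
DISPLAYED BINDERS, complete list: the kit's {`CG`, `hS`, `M : TorsionMonodromy`, `hA`, `hI`} ∪ the bad-pair DATA `B` with its LAWS `ΛBad`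
(`LocalArrowLaw`) ∪ the evaluation-section binders {`ES`} at `localDataOfBadPairs`.  No new `Prop` fact; typed ≠ inhabited ≠ proved;
binder ≠ fact; instantiated ≠ endorsed.  HONEST TAG carried from abc-iut-L5-t4: the ambient is OUR `ThetaAmb` (J-Θ-1 price recorded in
p462621's docstring); a datum over OUR interface witnesses OUR binders only and is NOT print's tempered `ℬ^temp(X̳_v̲)⁰`.
-/

noncomputable section

namespace Literature.IUT.HodgeTheaters

open CategoryTheory

universe u v w

section KitCoreThetaOfBadPairs

variable {F : Type u} {K : Type v} {Fbar : Type w} [Field F] [NumberField F] [Field K] [NumberField K]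
  [Algebra F K] [Field Fbar] [Algebra F Fbar] [Algebra K Fbar]
  {E : WeierstrassCurve F} [E.IsElliptic] {l : ℕ} {Pb : BadPlacePredicates K}
  (D : InitialThetaData F K Fbar E l Pb) (CG : D.geom.pe.CuspGalois) (hS : D.CuspClassesNormaliserStable) [Fact l.Prime]
  (M : D.TorsionMonodromy) (hA : D.geom.pe.ArrowCoveringClaims)
  (hI : ∀ k ∈ D.geom.pe.inertia D.geom.pe.ε1, M.tau (D.geom.embK k) = 0)

namespace InitialThetaData

/-! ### §1. The §4 base-Θ datum, `KitCore`, `NFLink` at the genuine-shape Θ-NF kit with parametric bad-pair data -/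

variable (B : ∀ v, v ∈ D.indexCopyBad → D.BadPairAt v) (ΛBad : ∀ v (h : v ∈ D.indexCopyBad), D.LocalArrowLaw CG hS (B v h).H)
  {Gv : D.IndexCopy → Subgroup (Fbar ≃ₐ[F] Fbar)}
  (ES : ∀ v, v ∈ D.indexCopyBad → EvalSectionBinder (D.localDataOfBadPairs CG hS M hA hI B ΛBad v) (Gv v))

/-- **THE [IUTchI] §4 BASE-Θ DATUM OF THE REAL INITIAL Θ-DATA over the genuine-shape Θ-NF kit with PARAMETRIC bad-pair data `B`**:
`ofKitCore` at `K := baseKitThetaNFOfBadPairs … B ΛBad`, `N := nfKitThetaOfBadPairs … B ΛBad`, `B' :=` tautological, `hl5 := five_le_l`, the two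
place theorems, and `E := evalBinderThetaNFOfBadPairs … ES` — Example 4.4's evaluation sections as DEGENERATE morphisms of `ThetaAmb` generated by
the sections `ES` at the local data `localDataOfBadPairs`. ([IUTchI] Def 4.1 p.95) [claim: Mochizuki2012, status: disputed] -/
def baseThetaDatumThetaOfBadPairs : BaseThetaDatum.{w} :=
  BaseThetaDatum.ofKitCore (D.baseKitThetaNFOfBadPairs CG hS M hA hI B ΛBad) D.five_le_l (D.indexCopy_not_mem_arc_of_mem_bad)
    D.indexCopyBad_nonempty (D.nfKitThetaOfBadPairs CG hS M hA hI B ΛBad) (PMBaseKit.MonoBinder.tautological _)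
    (D.evalBinderThetaNFOfBadPairs CG hS M hA hI B ΛBad D.five_le_l ES)

/-- **THE FROZEN `KitCore` AT THE GENUINE-SHAPE Θ-NF KIT WITH PARAMETRIC BAD-PAIR DATA, INHABITED**: the identity dictionary between
`baseThetaDatumThetaOfBadPairs B ΛBad ES` and `baseKitThetaNFOfBadPairs … B ΛBad` (the witness of abc-iut-L5-t4's
`nonempty_kitCore_baseKitThetaNFOfBadPairs` at `N := nfKitThetaOfBadPairs`, `B' :=` tautological). ([IUTchI] Def 6.1 p.156)
[claim: Mochizuki2012, status: disputed] -/
def kitCoreThetaOfBadPairs :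
    (D.baseThetaDatumThetaOfBadPairs CG hS M hA hI B ΛBad ES).KitCore (D.baseKitThetaNFOfBadPairs CG hS M hA hI B ΛBad) :=
  BaseThetaDatum.KitCore.ofKit (D.baseKitThetaNFOfBadPairs CG hS M hA hI B ΛBad) D.five_le_l (D.indexCopy_not_mem_arc_of_mem_bad)
    D.indexCopyBad_nonempty (D.nfKitThetaOfBadPairs CG hS M hA hI B ΛBad) (PMBaseKit.MonoBinder.tautological _)
    (D.evalBinderThetaNFOfBadPairs CG hS M hA hI B ΛBad D.five_le_l ES)

/-- **The `φ^NF` dictionary over `kitCoreThetaOfBadPairs`** (identity). ([IUTchI] Ex 4.3 (ii) p.99) [claim: Mochizuki2012, status: disputed] -/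
def nfLinkThetaOfBadPairs : (D.kitCoreThetaOfBadPairs CG hS M hA hI B ΛBad ES).NFLink :=
  BaseThetaDatum.NFLink.ofKit (D.baseKitThetaNFOfBadPairs CG hS M hA hI B ΛBad) D.five_le_l (D.indexCopy_not_mem_arc_of_mem_bad)
    D.indexCopyBad_nonempty (D.nfKitThetaOfBadPairs CG hS M hA hI B ΛBad) (PMBaseKit.MonoBinder.tautological _)
    (D.evalBinderThetaNFOfBadPairs CG hS M hA hI B ΛBad D.five_le_l ES)

/-! ### §2. Bookkeeping (`rfl`) -/

/-- Its prime is `l`. ([IUTchI] Def 3.1 (c) p.61) [claim: Mochizuki2012, status: disputed] -/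
theorem baseThetaDatumThetaOfBadPairs_l : (D.baseThetaDatumThetaOfBadPairs CG hS M hA hI B ΛBad ES).l = l := rfl

/-- Its places are the index copy of `V̲`. ([IUTchI] Def 3.1 (e) p.62) [claim: Mochizuki2012, status: disputed] -/
theorem baseThetaDatumThetaOfBadPairs_V : (D.baseThetaDatumThetaOfBadPairs CG hS M hA hI B ΛBad ES).V = D.IndexCopy := rfl

/-- Its bad places are `V̲^bad`. ([IUTchI] Def 3.1 (e) p.62) [claim: Mochizuki2012, status: disputed] -/
theorem baseThetaDatumThetaOfBadPairs_isBad_iff (x : D.IndexCopy) :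
    (D.baseThetaDatumThetaOfBadPairs CG hS M hA hI B ΛBad ES).IsBad x ↔ D.indexCopyVal x ∈ D.Vbad := D.mem_indexCopyBad_iff x

/-- Its archimedean places are `V̲^arc`. ([IUTchI] Def 3.1 (e) p.62) [claim: Mochizuki2012, status: disputed] -/
theorem baseThetaDatumThetaOfBadPairs_isArc_iff (x : D.IndexCopy) :
    (D.baseThetaDatumThetaOfBadPairs CG hS M hA hI B ΛBad ES).IsArc x ↔ D.indexCopyVal x ∈ D.Varc := D.mem_indexCopyArc_iff x

/-- Its `𝒟_v` is the genuine-shape Θ-NF kit's local model (as a local object). ([IUTchI] Def 4.1 (i) p.95) [claim: Mochizuki2012, status: disputed] -/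
theorem baseThetaDatumThetaOfBadPairs_D (x : D.IndexCopy) :
    (D.baseThetaDatumThetaOfBadPairs CG hS M hA hI B ΛBad ES).D x = (D.baseKitThetaNFOfBadPairs CG hS M hA hI B ΛBad).localModel x := rfl

/-- Its `𝒟^⊚` is `ℬ(Π_{C̲_K})⁰` among the isomorphs `GlobNF`. ([IUTchI] Def 4.1 (v) p.97) [claim: Mochizuki2012, status: disputed] -/
theorem baseThetaDatumThetaOfBadPairs_DG : (D.baseThetaDatumThetaOfBadPairs CG hS M hA hI B ΛBad ES).DG = D.gnfModel := rfl

/-- Its class `[ε]` is `1 ∈ 𝔽_l^⋇`. ([IUTchI] Ex 4.5 (ii) p.108) [claim: Mochizuki2012, status: disputed] -/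
theorem baseThetaDatumThetaOfBadPairs_εLab : (D.baseThetaDatumThetaOfBadPairs CG hS M hA hI B ΛBad ES).εLab = (1 : FlStar l) := rfl

/-- The dictionary's place map is the identity. ([IUTchI] Def 6.1 p.156) [claim: Mochizuki2012, status: disputed] -/
theorem kitCoreThetaOfBadPairs_e (x : D.IndexCopy) : (D.kitCoreThetaOfBadPairs CG hS M hA hI B ΛBad ES).e x = x := rfl

/-! ### §3. Non-vacuity of `KitCore`, (O1), and law (γ) at the genuine-shape Θ-NF kit with parametric bad-pair data -/

/-- **NON-VACUITY of the FROZEN `KitCore`** over the PARAMETRIC genuine-shape Θ-NF kit — for every bad-pair data `B`, laws `ΛBad` and family of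
evaluation-section binders `ES` there IS a §4 datum of the real initial Θ-data in `𝒟`-dictionary with the §6 Θ-NF kit.
([IUTchI] Def 6.1 p.156) [claim: Mochizuki2012, status: disputed] -/
theorem nonempty_kitCore_thetaOfBadPairs :
    Nonempty ((D.baseThetaDatumThetaOfBadPairs CG hS M hA hI B ΛBad ES).KitCore (D.baseKitThetaNFOfBadPairs CG hS M hA hI B ΛBad)) :=
  ⟨D.kitCoreThetaOfBadPairs CG hS M hA hI B ΛBad ES⟩

include ES in
open Classical in
/-- **(O1) met at every bad index** (abc-iut-w4-d054 p456090's necessary condition) over the PARAMETRIC genuine-shape Θ-NF kit: `𝒟_v̲` has a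
NON-invertible endomorphism — `⟨true, 𝟙, φ^Θ_{v̲_j}⟩` (by tag; not a statement about outer homomorphisms; abc-iut-L5-t4's
`exists_endo_not_isIso_baseKitThetaNFOfData` BY NAME). ([IUTchI] Ex 4.4 (i) p.106) [claim: Mochizuki2012, status: disputed] -/
theorem exists_endo_not_isIso_thetaOfBadPairs (v : D.IndexCopy) (hv : v ∈ D.indexCopyBad) (j : FlAbs l) :
    ∃ f : (D.baseKitThetaNFOfBadPairs CG hS M hA hI B ΛBad).model v ⟶ (D.baseKitThetaNFOfBadPairs CG hS M hA hI B ΛBad).model v,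
      ¬ IsIso f := by
  haveI := M.normal_PiXund_subgroupOf_PiXK
  exact D.exists_endo_not_isIso_baseKitThetaNFOfData CG hS (D.toFlStarGlobal_surjective_of_torsionMonodromy M) D.indexCopyBad D.indexCopyArc
    (D.localDataOfBadPairs CG hS M hA hI B ΛBad) v ((ES v hv).evalOuter j) ((ES v hv).isDegOver_evalOuter j)

/-- **LAW (γ) `KitCore.ThetaAgrees` AT THE GENUINE-SHAPE Θ-NF KIT WITH PARAMETRIC BAD-PAIR DATA** for the multiplicative kit generated by the
sections (`multKitThetaNFOfBadPairs`): Prop 6.7's «the kit's `φ^Θ_{v_j}` IS Example 4.4's `φ^Θ_{v_j}` read through the dictionary»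
(abc-iut-L5-t4's `thetaAgrees_baseKitThetaNFOfBadPairs` BY NAME at `N := nfKitThetaOfBadPairs`, `B' :=` tautological, `hl5 := five_le_l`).
DISPLAYED: {CG, hS, M, hA, hI} ∪ {B, ΛBad} ∪ {ES}. ([IUTchI] Prop 6.7 p.167) [claim: Mochizuki2012, status: disputed] -/
theorem thetaAgrees_thetaOfBadPairs :
    (D.kitCoreThetaOfBadPairs CG hS M hA hI B ΛBad ES).ThetaAgrees (D.multKitThetaNFOfBadPairs CG hS M hA hI B ΛBad ES) :=
  D.thetaAgrees_baseKitThetaNFOfBadPairs CG hS M hA hI B ΛBad D.five_le_l ES (D.nfKitThetaOfBadPairs CG hS M hA hI B ΛBad)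
    (PMBaseKit.MonoBinder.tautological _)

/-- **Existential packaging for certificates**: over the genuine-shape Θ-NF kit with parametric bad-pair data there EXIST a core agreement and a
multiplicative kit with law (γ). ([IUTchI] Prop 6.7 p.167) [claim: Mochizuki2012, status: disputed] -/
theorem exists_kitCore_thetaAgrees_thetaOfBadPairs :
    ∃ (c : (D.baseThetaDatumThetaOfBadPairs CG hS M hA hI B ΛBad ES).KitCore (D.baseKitThetaNFOfBadPairs CG hS M hA hI B ΛBad))
      (Mk : (D.baseKitThetaNFOfBadPairs CG hS M hA hI B ΛBad).MultKit), c.ThetaAgrees Mk :=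
  ⟨_, _, D.thetaAgrees_thetaOfBadPairs CG hS M hA hI B ΛBad ES⟩

/-! ### §4. The (C″) stand-in datum IS the special case `B := badPairAtArrow hA` (`rfl`; nothing of p465980 restated) -/

section StandIn

variable {Gv' : D.IndexCopy → Subgroup (Fbar ≃ₐ[F] Fbar)}
  (ES' : ∀ v, v ∈ D.indexCopyBad → EvalSectionBinder (D.localDataStandIn CG hS M hA hI v) (Gv' v))

/-- abc-iut-L5-t4's (C″) §4 datum `baseThetaDatumThetaStandIn ES'` IS `baseThetaDatumThetaOfBadPairs` at the `X̲→`-recipe bad pairs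
`B := badPairAtArrow hA`, laws `localArrowLaw_local_of_torsionMonodromy` (definitional). ([IUTchI] Def 4.1 p.95) [claim: Mochizuki2012, status: disputed] -/
theorem baseThetaDatumThetaStandIn_eq_ofBadPairs :
    D.baseThetaDatumThetaStandIn CG hS M hA hI ES' =
      D.baseThetaDatumThetaOfBadPairs CG hS M hA hI (fun v _ => D.badPairAtArrow hA v)
        (fun v _ => D.localArrowLaw_local_of_torsionMonodromy CG hS M hA hI (D.decompAt v)) ES' :=
  rfl

/-- … and the (C″) core `kitCoreThetaStandIn ES'` IS `kitCoreThetaOfBadPairs` there (definitional, heterogeneously along the previous `rfl`).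
([IUTchI] Def 6.1 p.156) [claim: Mochizuki2012, status: disputed] -/
theorem kitCoreThetaStandIn_eq_ofBadPairs :
    HEq (D.kitCoreThetaStandIn CG hS M hA hI ES')
      (D.kitCoreThetaOfBadPairs CG hS M hA hI (fun v _ => D.badPairAtArrow hA v)
        (fun v _ => D.localArrowLaw_local_of_torsionMonodromy CG hS M hA hI (D.decompAt v)) ES') :=
  HEq.rfl

end StandIn

end InitialThetaData

end KitCoreThetaOfBadPairs

end Literature.IUT.HodgeTheaters
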